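import Literature.AnabelianGeometry.EtaleTheta.SettingModelKrullCusp
import Literature.AnabelianGeometry.SemiGraphs.ProSigmaCuspInertiaMalnormalHolds
import Literature.AnabelianGeometry.SemiGraphs.SurfaceTypeLoopModels
import Literature.AnabelianGeometry.SemiGraphs.ProSigmaCompletionModels
import Literature.GroupTheory.CombinatorialGroupTheory.PuncturedSurfaceGroupFreeBasis
import Literature.IUT.HodgeTheaters.CommensuratorLemmas
import HarnessLib

/-!
# The commutator-axis cusp decomposition group is COMMENSURABLY TERMINAL — at the untwisted Krull carrier
# `modelκ′` and at EVERY twisted carrier `Γ ⋊_ψ G` stabilising the axis (census clause C7d at the `X`-level)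

Mochizuki, *The étale theta function …*, Publ. RIMS **45** (2009) [EtTh], §1 p. 13 («any decomposition group of a
cusp»), §2 p. 35 («the inertia group `I_x ⊆ D_x`»); [SemiAnbd] Thm. 6.5 (ii) p. 71 («the subgroup `D_x` is
commensurably terminal in `Π^temp_{X_K}`»), Example 2.10 p. 31 / [AbsAnab] Lemma 1.3.7 (cusp inertia in a pro-`Σ`
surface group is malnormal) [cite: MochizukiSemiAnbd2006, Thm 6.5 (ii) p.71]. Cell abc-iut, layer L2 (NV lane),
seat abc-iut-L2-t5 (gen 7), row R291 of abc-iut-L2-lead («twisted commutator-axis-cusp carrier + the kernel verdict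
on the C7d clause»). PROOF-ONLY (0 definitions); every object is consumed BY NAME: abc-iut-w5-d165's commutator axis
`cAxis = ⟨η⁅a,b⁆⟩⁻ ⊆ F̂₂`, `cAxisGfp = c^Ẑ ⊆ Γ` (`SettingModel2CommutatorCusp`), abc-iut-L2-t10's cusp datum
`cuspDecompκ p = c^Ẑ ⋊ G_{ℚ_p} ≤ Π^tp_X` of `ThetaSetting.modelκ′` (`SettingModelKrullCusp`), abc-iut-L3 /
abc-iut-w5-d016 / abc-iut-w5-d051's PROVED [SemiAnbd] Ex. 2.10 malnormality
(`cuspInertia_closure_isCommensurablyTerminal`, `ProSigmaCuspInertiaMalnormalHolds`), abc-iut-L3's model of the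
pro-`Σ` interface (`isProSigmaCompletion_toCompletion`, `comp_mulEquiv`) and free basis of `Γ_{1,1}` (`freeEquiv 1 0`,
`c₁ ↦ ⁅a,b⁆⁻¹`).

RESULTS.
* §0 group theory (over abc-iut-L5's `CommensuratorLemmas`, `map_conj_smul` BY NAME): commensurability under `comap` /
  injective `map`, `MulAut.conj` vs `ConjAct` bookkeeping, and the
  equivalence «`K` commensurably terminal ⇔ `∀ g, Commensurable (g·K·g⁻¹) K → g ∈ K`» (the SHAPE of the census
  clause C7d / of the binders `hCTα`, `hCTβ` of `GalSectThm110iiiCuspPairTransport`).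
* §1 **`isCommensurablyTerminal_cAxis`**: `c^Ẑ = ⟨η⁅a,b⁆⟩⁻` is commensurably terminal in `F̂₂` — the tree's
  [SemiAnbd] Ex. 2.10 theorem at `(g, r) = (1, 1)`, `Σ = {all primes}`, `P = F̂₂`, `ι = η ∘ (Γ_{1,1} ≅ F₂)`;
  **`mem_cAxisGfp_of_commensurable`**: the same inside `Γ = F̂₂ ×_Ẑ ℤ` (push forward along the injective `pr₁`).
* §2 **`mem_of_commensurable_conj_smul_of_left_mem_cAxisGfp`** — GENERIC in the twist: for ANY group `G`, ANY action
  `ψ : G →* Aut Γ` and any subgroup `D ≤ Γ ⋊_ψ G` with `g ∈ D ↔ g.left ∈ c^Ẑ` (so `D = c^Ẑ ⋊ G`, which forces `ψ`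
  to stabilise the axis), `Commensurable (g·D·g⁻¹) D → g ∈ D`: the `G`-factor of `g` lies in `D`, so only the
  `Γ`-factor matters, and pulling back along `inl : Γ → Γ ⋊ G` reduces the claim to §1. Twisting the Galois action
  (by the cyclotomic character or anything else stabilising `c^Ẑ`) does not affect the clause.
* §3 INSTANCE at the carrier of record: **`isCommensurablyTerminal_cuspDecompκ`** (`D_x` of `modelκ′` is
  commensurably terminal in `Π^tp_X`), the C7d shape `cuspDecompκ_commTerminal`, and the `ThetaSetting`-level
  restatement `decomp_modelκ'_commTerminal` for every (cuspidal) point of `modelκ′`.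

READING (numbers, not taste): the `X`-level content of C7d HOLDS at the UNTWISTED commutator-axis carrier already;
the commensurator of `c^Ẑ ⋊ G` in `Γ ⋊_ψ G` is `Comm_Γ(c^Ẑ) ⋊ G = c^Ẑ ⋊ G` for every `ψ`. SEMI-SYNTHETIC carriers
(consistency evidence only); classical profinite group theory under OUR kernel check; nothing of [EtTh]/[SemiAnbd]
asserted beyond the tree's own theorems; no side taken on [IUTchIII] Cor. 3.12; typed ≠ proved.
-/

noncomputable section

open scoped Pointwise

namespace Literature.AnabelianGeometry.EtaleTheta.SettingModel

open Literature.AnabelianGeometry.SemiGraphs Literature.AnabelianGeometry.AbsoluteAnabelian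
open Literature.GroupTheory.CombinatorialGroupTheory Function _root_.Topology
open scoped commutatorElement

/-! ## §0. Group theory: commensurability bookkeeping -/

section GroupTheory

variable {A B : Type*} [Group A] [Group B]

/-- Commensurability pulls back along any homomorphism (`[K ∩ f(A) : …] ≤ [K : H ∩ K]`).
[cite: MochizukiAbsAnab2004, Def 0.1 (iii) p.4] -/
theorem commensurable_comap (f : A →* B) {H K : Subgroup B} (h : Subgroup.Commensurable H K) :
    Subgroup.Commensurable (H.comap f) (K.comap f) := by
  constructor
  · rw [Subgroup.relIndex_comap]
    exact fun h0 => h.1 (Subgroup.relIndex_eq_zero_of_le_right (Subgroup.map_comap_le f K) h0)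
  · rw [Subgroup.relIndex_comap]
    exact fun h0 => h.2 (Subgroup.relIndex_eq_zero_of_le_right (Subgroup.map_comap_le f H) h0)

/-- Commensurability pushes forward along an injective homomorphism.
[cite: MochizukiAbsAnab2004, Def 0.1 (iii) p.4] -/
theorem commensurable_map_of_injective {f : A →* B} (hf : Injective f) {H K : Subgroup A}
    (h : Subgroup.Commensurable H K) : Subgroup.Commensurable (H.map f) (K.map f) := by
  unfold Subgroup.Commensurable at h ⊢
  rwa [Subgroup.relIndex_map_map_of_injective _ _ hf, Subgroup.relIndex_map_map_of_injective _ _ hf]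

/-- `f⁻¹(f(a)·H·f(a)⁻¹) = a·f⁻¹(H)·a⁻¹`. [cite: MochizukiAbsAnab2004, Def 0.1 (iii) p.4] -/
theorem comap_conj_smul (f : A →* B) (a : A) (H : Subgroup B) :
    (MulAut.conj (f a) • H).comap f = MulAut.conj a • H.comap f := by
  ext x
  simp only [Subgroup.mem_comap, Subgroup.mem_pointwise_smul_iff_inv_smul_mem, MulAut.smul_def,
    MulAut.conj_inv_apply, map_mul, map_inv]

/-- The two spellings of conjugating a subgroup agree: `MulAut.conj g • H = ConjAct.toConjAct g • H`.
[cite: MochizukiAbsAnab2004, Def 0.1 (iii) p.4] -/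
theorem conj_smul_eq_toConjAct_smul (g : A) (H : Subgroup A) :
    MulAut.conj g • H = ConjAct.toConjAct g • H := by
  ext x
  simp only [Subgroup.mem_smul_pointwise_iff_exists, MulAut.smul_def, MulAut.conj_apply, ConjAct.smul_def,
    ConjAct.ofConjAct_toConjAct]

/-- A commensurably terminal subgroup contains every element commensurating it — the SHAPE of census clause C7d
(`∀ g, Commensurable (g·D·g⁻¹) D → g ∈ D`). [cite: MochizukiAbsAnab2004, Def 0.1 (iii) p.4] -/
theorem mem_of_isCommensurablyTerminal {K : Subgroup A} (hK : IsCommensurablyTerminal K) {g : A}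
    (hg : Subgroup.Commensurable (MulAut.conj g • K) K) : g ∈ K := by
  rw [← hK.commensurator_eq, Subgroup.Commensurable.commensurator_mem_iff, ← conj_smul_eq_toConjAct_smul]
  exact hg

/-- Conversely, the C7d shape gives commensurable terminality. [cite: MochizukiAbsAnab2004, Def 0.1 (iii) p.4] -/
theorem isCommensurablyTerminal_of_forall {K : Subgroup A}
    (h : ∀ g, Subgroup.Commensurable (MulAut.conj g • K) K → g ∈ K) : IsCommensurablyTerminal K := by
  refine ⟨le_antisymm (fun g hg => h g ?_) fun k hk => ?_⟩
  · rwa [Subgroup.Commensurable.commensurator_mem_iff, ← conj_smul_eq_toConjAct_smul] at hg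
  · rw [Subgroup.Commensurable.commensurator_mem_iff, ← conj_smul_eq_toConjAct_smul,
      Subgroup.conj_smul_eq_self_of_mem hk]

/-- `IsCommensurablyTerminal K ↔` the C7d shape. [cite: MochizukiAbsAnab2004, Def 0.1 (iii) p.4] -/
theorem isCommensurablyTerminal_iff_forall (K : Subgroup A) :
    IsCommensurablyTerminal K ↔ ∀ g, Subgroup.Commensurable (MulAut.conj g • K) K → g ∈ K :=
  ⟨fun hK _ hg => mem_of_isCommensurablyTerminal hK hg, isCommensurablyTerminal_of_forall⟩

/-- Commensurable terminality transports BACK along an injective homomorphism onto a subgroup containing the image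
question: if `f` is injective, `f(K)` is commensurably terminal in `B`, then `K` is commensurably terminal in `A`.
[cite: MochizukiAbsAnab2004, Def 0.1 (iii) p.4] -/
theorem isCommensurablyTerminal_of_map_of_injective {f : A →* B} (hf : Injective f) {K : Subgroup A}
    (hK : IsCommensurablyTerminal (K.map f)) : IsCommensurablyTerminal K := by
  refine isCommensurablyTerminal_of_forall fun g hg => ?_
  have h1 : Subgroup.Commensurable (MulAut.conj (f g) • K.map f) (K.map f) := by
    rw [← Literature.IUT.HodgeTheaters.map_conj_smul]
    exact commensurable_map_of_injective hf hg
  obtain ⟨k, hk, hfk⟩ := Subgroup.mem_map.mp (mem_of_isCommensurablyTerminal hK h1)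
  rwa [← hf hfk]

end GroupTheory

/-! ## §1. `c^Ẑ` is commensurably terminal in `F̂₂` and in `Γ` ([SemiAnbd] Ex. 2.10 at `(g,r) = (1,1)`) -/

/-- The free basis `Γ_{1,1} = ⟨a, b, c ∣ [a,b]c⟩ ≅ F₂ = F(x₀, x₁)` of the tree (`freeEquiv 1 0`: `a ↦ x₀`, `b ↦ x₁`,
`c ↦ ⁅x₀,x₁⁆⁻¹`) carries the cusp generator to the INVERSE of the boundary commutator `cElt = ⁅x₀, x₁⁆`.
[cite: MochizukiSemiAnbd2006, Ex. 2.10 p.31] -/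
theorem freeEquiv_trans_congr_c_zero :
    ((PuncturedSurfaceGroup.freeEquiv 1 0).trans
        (FreeGroup.freeGroupCongr
          ((Equiv.sumEmpty (Fin 1 × Bool) (Fin 0)).trans
            ((Equiv.uniqueProd Bool (Fin 1)).trans finTwoEquiv.symm))))
      (PuncturedSurfaceGroup.c 0) = cElt⁻¹ := by
  rw [MulEquiv.trans_apply, PuncturedSurfaceGroup.freeEquiv_c_zero]
  simp only [PuncturedSurfaceGroup.commProd, PuncturedSurfaceGroup.cuspProd, List.finRange_succ,
    List.finRange_zero, List.map_cons, List.map_nil, List.prod_cons, List.prod_nil, mul_one, inv_one,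
    map_inv, map_mul, FreeGroup.freeGroupCongr_apply, FreeGroup.map.of, commutatorElement_def]
  rfl

/-- **`c^Ẑ = ⟨η⁅a,b⁆⟩⁻` is commensurably terminal in `F̂₂`**: the tree's [SemiAnbd] Ex. 2.10 theorem
`cuspInertia_closure_isCommensurablyTerminal` (cusp inertia in the pro-`Σ` completion of a hyperbolic `Γ_{g,r}`)
at `(g, r) = (1, 1)`, `Σ = {all primes}`, `P = F̂₂`, `ι = η ∘ (Γ_{1,1} ≅ F₂)` — the closure of `ι⟨c₁⟩ = ⟨η⁅a,b⁆⁻¹⟩`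
is abc-iut-w5-d165's `cAxis`. [cite: MochizukiSemiAnbd2006, Ex. 2.10 p.31] -/
theorem isCommensurablyTerminal_cAxis : IsCommensurablyTerminal cAxis := by
  -- the comparison `Γ_{1,1} ≅ F₂`
  let e : PuncturedSurfaceGroup 1 (0 + 1) ≃* F₂ :=
    (PuncturedSurfaceGroup.freeEquiv 1 0).trans
      (FreeGroup.freeGroupCongr
        ((Equiv.sumEmpty (Fin 1 × Bool) (Fin 0)).trans ((Equiv.uniqueProd Bool (Fin 1)).trans finTwoEquiv.symm)))
  have hι : SemiGraphOfAnabelioids.IsProSigmaCompletion {p : ℕ | p.Prime} (eta.comp e.toMonoidHom) :=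
    (SemiGraphOfAnabelioids.IsProSigmaCompletion.isProSigmaCompletion_toCompletion F₂).comp_mulEquiv e
  have hhyp : PuncturedSurfaceGroup.IsHyperbolicType 1 (0 + 1) := by
    change 2 < 2 * 1 + (0 + 1); norm_num
  have hT := SemiGraphOfAnabelioids.cuspInertia_closure_isCommensurablyTerminal (P := F₂hatT)
    (Sigma := {p : ℕ | p.Prime}) ⟨2, Nat.prime_two⟩ (fun p hp => hp) hhyp (eta.comp e.toMonoidHom) hι 0
  -- identify the closed cusp inertia with `cAxis`
  have hc : e (PuncturedSurfaceGroup.c 0) = cElt⁻¹ := freeEquiv_trans_congr_c_zero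
  have hmap : ((PuncturedSurfaceGroup.cuspInertia (g := 1) (0 : Fin (0 + 1))).map (eta.comp e.toMonoidHom)) =
      Subgroup.zpowers (eta cElt) := by
    rw [PuncturedSurfaceGroup.cuspInertia, MonoidHom.map_zpowers, MonoidHom.comp_apply, MulEquiv.coe_toMonoidHom,
      hc, map_inv, Subgroup.zpowers_inv]
  rwa [hmap, ← cAxis_eq_closure_zpowers] at hT

/-- The C7d shape in `F̂₂`: an element commensurating `c^Ẑ` lies on it. [cite: MochizukiSemiAnbd2006, Ex. 2.10 p.31] -/
theorem mem_cAxis_of_commensurable {x : F₂hatT} (hx : Subgroup.Commensurable (MulAut.conj x • cAxis) cAxis) :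
    x ∈ cAxis :=
  mem_of_isCommensurablyTerminal isCommensurablyTerminal_cAxis hx

/-- **`c^Ẑ` is commensurably terminal in `Γ = F̂₂ ×_Ẑ ℤ`** (push forward along the injective `pr₁ : Γ → F̂₂`, whose
image of `cAxisGfp` is `cAxis`). [cite: MochizukiSemiAnbd2006, Ex. 2.10 p.31] -/
theorem isCommensurablyTerminal_cAxisGfp : IsCommensurablyTerminal cAxisGfp :=
  isCommensurablyTerminal_of_map_of_injective (f := gfpFst.toMonoidHom) gfpFst_injective
    (by rw [map_gfpFst_cAxisGfp]; exact isCommensurablyTerminal_cAxis)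

/-- The C7d shape in `Γ`. [cite: MochizukiSemiAnbd2006, Ex. 2.10 p.31] -/
theorem mem_cAxisGfp_of_commensurable {γ : Gfp} (hγ : Subgroup.Commensurable (MulAut.conj γ • cAxisGfp) cAxisGfp) :
    γ ∈ cAxisGfp :=
  mem_of_isCommensurablyTerminal isCommensurablyTerminal_cAxisGfp hγ

/-! ## §2. GENERIC in the twist: `c^Ẑ ⋊ G ≤ Γ ⋊_ψ G` is commensurably terminal for every action `ψ` -/

section Twisted

variable {G : Type*} [Group G] {ψ : G →* MulAut Gfp}

/-- For `D = c^Ẑ ⋊ G` (membership read on the `Γ`-component), the Galois factor `inr σ` lies in `D`.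
[cite: MochizukiEtTh2009, §1 p.13] -/
theorem inr_mem_of_left_mem_cAxisGfp (D : Subgroup (Gfp ⋊[ψ] G)) (hD : ∀ g, g ∈ D ↔ g.left ∈ cAxisGfp) (σ : G) :
    (SemidirectProduct.inr σ : Gfp ⋊[ψ] G) ∈ D := by
  rw [hD, SemidirectProduct.left_inr]; exact Subgroup.one_mem _

/-- Such a `D` forces the action to stabilise the axis: `ψ σ (c^Ẑ) ⊆ c^Ẑ`. [cite: MochizukiEtTh2009, §1 p.13] -/
theorem apply_mem_cAxisGfp_of_left_mem (D : Subgroup (Gfp ⋊[ψ] G)) (hD : ∀ g, g ∈ D ↔ g.left ∈ cAxisGfp)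
    (σ : G) {γ : Gfp} (hγ : γ ∈ cAxisGfp) : ψ σ γ ∈ cAxisGfp := by
  have h : (SemidirectProduct.inl (ψ σ γ) : Gfp ⋊[ψ] G) ∈ D := by
    rw [SemidirectProduct.inl_aut]
    exact D.mul_mem (D.mul_mem (inr_mem_of_left_mem_cAxisGfp D hD σ) (by rwa [hD, SemidirectProduct.left_inl]))
      (inr_mem_of_left_mem_cAxisGfp D hD σ⁻¹)
  rwa [hD, SemidirectProduct.left_inl] at h

/-- `inl⁻¹(D) = c^Ẑ`. [cite: MochizukiEtTh2009, §1 p.13] -/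
theorem comap_inl_eq_cAxisGfp (D : Subgroup (Gfp ⋊[ψ] G)) (hD : ∀ g, g ∈ D ↔ g.left ∈ cAxisGfp) :
    D.comap (SemidirectProduct.inl : Gfp →* Gfp ⋊[ψ] G) = cAxisGfp := by
  ext γ
  rw [Subgroup.mem_comap, hD, SemidirectProduct.left_inl]

/-- **GENERIC C7d at the `X`-level.** For any group `G`, any action `ψ : G →* Aut Γ` and any subgroup
`D ≤ Γ ⋊_ψ G` with `g ∈ D ↔ g.left ∈ c^Ẑ` (i.e. `D = c^Ẑ ⋊ G`, the commutator-axis cusp decomposition group of a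
semidirect carrier, twisted or not): every element commensurating `D` lies in `D`. Proof: write `g = inl γ · inr σ`
with `inr σ ∈ D`; pull `Commensurable (inl γ·D·(inl γ)⁻¹) D` back along `inl` to `Commensurable (γ·c^Ẑ·γ⁻¹) c^Ẑ` in
`Γ`; conclude by §1. [cite: MochizukiSemiAnbd2006, Thm 6.5 (ii) p.71] -/
theorem mem_of_commensurable_conj_smul_of_left_mem_cAxisGfp (D : Subgroup (Gfp ⋊[ψ] G))
    (hD : ∀ g, g ∈ D ↔ g.left ∈ cAxisGfp) (g : Gfp ⋊[ψ] G)
    (hg : Subgroup.Commensurable (MulAut.conj g • D) D) : g ∈ D := by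
  -- reduce to the `Γ`-factor
  have hsplit : g = SemidirectProduct.inl g.left * SemidirectProduct.inr g.right :=
    (SemidirectProduct.inl_left_mul_inr_right g).symm
  have hg' : Subgroup.Commensurable (MulAut.conj (SemidirectProduct.inl g.left : Gfp ⋊[ψ] G) • D) D := by
    have h := hg
    rw [hsplit, map_mul, mul_smul, Subgroup.conj_smul_eq_self_of_mem (inr_mem_of_left_mem_cAxisGfp D hD g.right)]
      at h
    exact h
  -- pull back along `inl`
  have hγ : Subgroup.Commensurable (MulAut.conj g.left • cAxisGfp) cAxisGfp := by
    have h := commensurable_comap (SemidirectProduct.inl : Gfp →* Gfp ⋊[ψ] G) hg'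
    rwa [comap_conj_smul, comap_inl_eq_cAxisGfp D hD] at h
  exact (hD g).mpr (mem_cAxisGfp_of_commensurable hγ)

/-- **`c^Ẑ ⋊ G` is commensurably terminal in `Γ ⋊_ψ G`, for every `ψ`.** [cite: MochizukiSemiAnbd2006, Thm 6.5 (ii) p.71] -/
theorem isCommensurablyTerminal_of_left_mem_cAxisGfp (D : Subgroup (Gfp ⋊[ψ] G))
    (hD : ∀ g, g ∈ D ↔ g.left ∈ cAxisGfp) : IsCommensurablyTerminal D :=
  isCommensurablyTerminal_of_forall (mem_of_commensurable_conj_smul_of_left_mem_cAxisGfp D hD)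

/-- Hence also NORMALLY terminal ([AbsAnab] Rmk 0.1.2). [cite: MochizukiAbsAnab2004, Rem 0.1.2 p.4] -/
theorem isNormallyTerminal_of_left_mem_cAxisGfp (D : Subgroup (Gfp ⋊[ψ] G))
    (hD : ∀ g, g ∈ D ↔ g.left ∈ cAxisGfp) : IsNormallyTerminal D :=
  (isCommensurablyTerminal_of_left_mem_cAxisGfp D hD).isNormallyTerminal

end Twisted

/-! ## §3. INSTANCE: the cusp decomposition group of the untwisted Krull carrier `modelκ′` -/

variable (p : ℕ) [Fact p.Prime]

/-- **`D_x = c^Ẑ ⋊ G_{ℚ_p}` of `modelκ′` is COMMENSURABLY TERMINAL in `Π^tp_X = Γ ⋊_{θ∘1} G_{ℚ_p}`** ([SemiAnbd]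
Thm. 6.5 (ii) at abc-iut-L2-t10's untwisted Krull carrier; census clause C7d at the `X`-level HOLDS there).
[cite: MochizukiSemiAnbd2006, Thm 6.5 (ii) p.71] -/
theorem isCommensurablyTerminal_cuspDecompκ : IsCommensurablyTerminal (cuspDecompκ p) :=
  isCommensurablyTerminal_of_left_mem_cAxisGfp (cuspDecompκ p) (mem_cuspDecompκ_iff p)

/-- The C7d SHAPE at `modelκ′`: `∀ g, Commensurable (g·D_x·g⁻¹) D_x → g ∈ D_x`. [cite: MochizukiSemiAnbd2006, Thm 6.5 (ii) p.71] -/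
theorem cuspDecompκ_commTerminal (g : PiTpκ p) (hg : Subgroup.Commensurable (MulAut.conj g • cuspDecompκ p) (cuspDecompκ p)) :
    g ∈ cuspDecompκ p :=
  mem_of_commensurable_conj_smul_of_left_mem_cAxisGfp (cuspDecompκ p) (mem_cuspDecompκ_iff p) g hg

/-- `D_x` of `modelκ′` is normally terminal in `Π^tp_X`. [cite: MochizukiSemiAnbd2006, Thm 6.5 (ii) p.71] -/
theorem isNormallyTerminal_cuspDecompκ : IsNormallyTerminal (cuspDecompκ p) :=
  (isCommensurablyTerminal_cuspDecompκ p).isNormallyTerminal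

/-- **At the `ThetaSetting` level**: for every point `x` of `modelκ′` (all points are the one cusp, `decomp x =
cuspDecompκ p`), the decomposition group `decomp x` is commensurably terminal in `Π^tp_X`.
[cite: MochizukiSemiAnbd2006, Thm 6.5 (ii) p.71] -/
theorem isCommensurablyTerminal_decomp_modelκ' (x : (ThetaSetting.modelκ' p).Pt) :
    IsCommensurablyTerminal ((ThetaSetting.modelκ' p).decomp x) :=
  isCommensurablyTerminal_cuspDecompκ p

/-- The C7d shape for `decomp x` at `modelκ′`. [cite: MochizukiSemiAnbd2006, Thm 6.5 (ii) p.71] -/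
theorem decomp_modelκ'_commTerminal (x : (ThetaSetting.modelκ' p).Pt) (g : (ThetaSetting.modelκ' p).PiTemp)
    (hg : Subgroup.Commensurable (MulAut.conj g • (ThetaSetting.modelκ' p).decomp x) ((ThetaSetting.modelκ' p).decomp x)) :
    g ∈ (ThetaSetting.modelκ' p).decomp x :=
  cuspDecompκ_commTerminal p g hg

/-- Every CONJUGATE `h·D_x·h⁻¹` (i.e. every cuspidal decomposition group of `modelκ′`) is commensurably terminal too.
[cite: MochizukiSemiAnbd2006, Thm 6.5 (ii) p.71] -/
theorem isCommensurablyTerminal_conj_cuspDecompκ (h : PiTpκ p) :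
    IsCommensurablyTerminal (MulAut.conj h • cuspDecompκ p) := by
  refine isCommensurablyTerminal_of_forall fun g hg => ?_
  have key : ∀ K : Subgroup (PiTpκ p), MulAut.conj h⁻¹ • K = ConjAct.toConjAct h⁻¹ • K :=
    fun K => conj_smul_eq_toConjAct_smul _ K
  have h2 : Subgroup.Commensurable (MulAut.conj h⁻¹ • (MulAut.conj g • MulAut.conj h • cuspDecompκ p))
      (MulAut.conj h⁻¹ • (MulAut.conj h • cuspDecompκ p)) := by
    rw [key, key]; exact hg.conj _
  have e1 : MulAut.conj h⁻¹ • (MulAut.conj g • MulAut.conj h • cuspDecompκ p) =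
      MulAut.conj (h⁻¹ * g * h) • cuspDecompκ p := by
    simp only [smul_smul, ← map_mul, mul_assoc]
  have e2 : MulAut.conj h⁻¹ • (MulAut.conj h • cuspDecompκ p) = cuspDecompκ p := by
    rw [smul_smul, ← map_mul, inv_mul_cancel, map_one, one_smul]
  rw [e1, e2] at h2
  have h3 := cuspDecompκ_commTerminal p _ h2
  rw [Subgroup.mem_smul_pointwise_iff_exists]
  exact ⟨h⁻¹ * g * h, h3, by rw [MulAut.smul_def, MulAut.conj_apply]; group⟩

end Literature.AnabelianGeometry.EtaleTheta.SettingModel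

end
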